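import Summits.RiemannHypothesis.RiemannHypothesis.Theorems.UniversalFactorLehmerRepresentation
import Summits.RiemannHypothesis.RiemannHypothesis.Theorems.UniversalFactorLaguerreCriterion
import Literature.NumberTheory.LFunctions.LFDSingleGram
import Literature.Analysis.SpecialFunctions.GammaStirlingVertical

/-!
# RiemannHypothesis / UniversalFactor — tail bounds for the one-sided Laplace(16) averages of `H_0`
relative to `K₀ = π^{-1/4}|Γ(¼ + it₀/2)|/16`

Route `RiemannHypothesis/UniversalFactor`, item `LehmerPointNoGo` (stmt-RiemannHypothesis-2582).
The certificate computes `∫₀^∞ H_0(2t₀ ∓ y) e^{−16y} dy / K₀` by certified quadrature on `y ≤ Y`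
(`Y ≈ 1.7`); this file bounds the remainders `∫_{y > Y}` by explicit elementary functions of `t₀, Y`:

* `UniversalFactor.norm_deBruijnH_zero_two_mul_eq` — `‖H_0(2t)‖ = (t²+¼) π^{-1/4} |Γ(¼+it/2)| |ζ(½+it)| / 16`;
* `UniversalFactor.norm_Gamma_thetaArg_le` — for `t, t₀ ≥ 2`:
  `|Γ(¼+it/2)| ≤ |Γ(¼+it₀/2)| · exp(log(t₀/2)/4 + 3/64 + π/4 + 1 + (π/4)(t₀ − t))`
  (Stirling on the vertical line `Re = ¼`, `GammaStirling.abs_log_norm_Gamma_vertical_sub_le_of_pos`);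
* `UniversalFactor.norm_deBruijnH_zero_two_mul_le` — for `t ≥ 2`:
  `‖H_0(2t)‖ ≤ K₀ · C(t₀) · (t + 1)³ · e^{(π/4)(t₀ − t)}`, `C(t₀) = 5 exp(log(t₀/2)/4 + 3/64 + π/4 + 1)`
  (`‖ζ(s)‖ ≤ 5‖s‖`, `LFDSingle.norm_riemannZeta_le_five_mul`);
* `UniversalFactor.norm_deBruijnH_zero_le_quarter` — `‖H_0(x)‖ ≤ ¼` for all real `x`
  (`|H_0(x)| ≤ H_0(0) = −Λ(½)/64`, `Γ(¼) ≤ 4`, `|ζ(½)| ≤ 4`), and `UniversalFactor.lehmerK0_ge`;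
* `UniversalFactor.lehmer_tail_Q`, `UniversalFactor.lehmer_tail_P` — the two tail bounds.

References: E. C. Titchmarsh, *The Theory of the Riemann Zeta-Function* (1986), §2.1, §2.12, §4.12.
-/

noncomputable section

set_option linter.dupNamespace false

namespace Summit.RiemannHypothesis.RiemannHypothesis.Theorems

open Complex Real Set MeasureTheory
open Literature.NumberTheory.LFunctions
open Literature.Analysis.SpecialFunctions (GammaStirling.abs_log_norm_Gamma_vertical_sub_le_of_pos)

/-! ## `‖H_0(2t)‖` on the real axis -/

/-- `‖Γ_ℝ(½ + it)‖ = π^{-1/4} |Γ(¼ + it/2)|`. [folklore] -/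
theorem UniversalFactor.norm_Gammaℝ_half (t : ℝ) :
    ‖Gammaℝ (1 / 2 + t * I)‖ = Real.exp (-Real.log π / 4) * ‖Complex.Gamma (thetaArg t)‖ := by
  rw [Gammaℝ_half_add_mul_I, norm_mul, Complex.norm_real, Real.norm_of_nonneg (Real.exp_pos _).le,
    norm_thetaGamma_thetaArg_eq_norm_Gamma]

/-- `‖H_0(2t)‖ = (t² + ¼) · π^{-1/4} |Γ(¼ + it/2)| · |ζ(½ + it)| / 16` for every real `t`. [folklore] -/
theorem UniversalFactor.norm_deBruijnH_zero_two_mul_eq (t : ℝ) :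
    ‖deBruijnH 0 ((2 * t : ℝ) : ℂ)‖ =
      (t ^ 2 + 1 / 4) * (Real.exp (-Real.log π / 4) * ‖Complex.Gamma (thetaArg t)‖) *
        ‖riemannZeta (1 / 2 + t * I)‖ / 16 := by
  rw [UniversalFactor.deBruijnH_zero_two_mul t, UniversalFactor.completedRiemannZeta_half]
  simp only [norm_mul, norm_neg, norm_div, norm_one, Complex.norm_ofNat]
  have hss : ‖((1 : ℂ) / 2 + t * I)‖ * ‖(1 - ((1 : ℂ) / 2 + t * I))‖ = t ^ 2 + 1 / 4 := by
    rw [← norm_mul, show ((1 : ℂ) / 2 + t * I) * (1 - (1 / 2 + t * I)) = ((1 / 4 + t ^ 2 : ℝ) : ℂ) by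
      push_cast; ring_nf; rw [Complex.I_sq]; ring, Complex.norm_real, Real.norm_eq_abs,
      abs_of_nonneg (by positivity)]
    ring
  rw [hss, ← UniversalFactor.norm_Gammaℝ_half]
  ring

/-- **Stirling ratio on `Re = ¼`**: for `t, t₀ ≥ 2`,
`|Γ(¼ + it/2)| ≤ |Γ(¼ + it₀/2)| · exp(log(t₀/2)/4 + 3/64 + π/4 + 1 + (π/4)(t₀ − t))`. [folklore] -/
theorem UniversalFactor.norm_Gamma_thetaArg_le {t₀ t : ℝ} (ht₀ : 2 ≤ t₀) (ht : 2 ≤ t) :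
    ‖Complex.Gamma (thetaArg t)‖ ≤ ‖Complex.Gamma (thetaArg t₀)‖ *
      Real.exp (Real.log (t₀ / 2) / 4 + 3 / 64 + π / 4 + 1 + π / 4 * (t₀ - t)) := by
  have key : ∀ u : ℝ, 2 ≤ u →
      |Real.log ‖Complex.Gamma (thetaArg u)‖ -
        ((1 / 4 - 1 / 2) * Real.log |u / 2| - π * |u / 2| / 2 + Real.log (2 * π) / 2)| ≤
        (1 / 4 + 1 / 2) * (1 / 4) ^ 2 / 2 + π * (1 / 4) / 2 + 1 / 4 + 1 / 4 := by
    intro u hu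
    have h := GammaStirling.abs_log_norm_Gamma_vertical_sub_le_of_pos (x := 1 / 4) (u := u / 2)
      (by norm_num) (by rw [abs_of_nonneg (by linarith)]; linarith)
    have e : (((1 / 4 : ℝ) : ℂ) + ((u / 2 : ℝ) : ℂ) * I) = thetaArg u := by
      simp only [thetaArg]; push_cast; ring
    rwa [e] at h
  have h1 := key t ht
  have h0 := key t₀ ht₀
  rw [abs_of_nonneg (by linarith : 0 ≤ t / 2)] at h1
  rw [abs_of_nonneg (by linarith : 0 ≤ t₀ / 2)] at h0
  have hΓt : 0 < ‖Complex.Gamma (thetaArg t)‖ :=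
    norm_pos_iff.2 (Complex.Gamma_ne_zero_of_re_pos (thetaArg_re_pos t))
  have hΓ0 : 0 < ‖Complex.Gamma (thetaArg t₀)‖ :=
    norm_pos_iff.2 (Complex.Gamma_ne_zero_of_re_pos (thetaArg_re_pos t₀))
  have hlogt : 0 ≤ Real.log (t / 2) := Real.log_nonneg (by linarith)
  rw [← Real.exp_log hΓt, ← Real.exp_log hΓ0, ← Real.exp_add, Real.exp_le_exp]
  have := (abs_le.1 h1).2
  have := (abs_le.1 h0).1
  nlinarith [Real.pi_pos]

/-- **`‖H_0(2t)‖ ≤ K₀ · C(t₀) · (t+1)³ · e^{(π/4)(t₀ − t)}`** for `t, t₀ ≥ 2`. [folklore] -/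
theorem UniversalFactor.norm_deBruijnH_zero_two_mul_le {t₀ t : ℝ} (ht₀ : 2 ≤ t₀) (ht : 2 ≤ t) :
    ‖deBruijnH 0 ((2 * t : ℝ) : ℂ)‖ ≤ UniversalFactor.lehmerK0 t₀ * UniversalFactor.lehmerTailConst t₀ *
      (t + 1) ^ 3 * Real.exp (π / 4 * (t₀ - t)) := by
  rw [UniversalFactor.norm_deBruijnH_zero_two_mul_eq]
  have hΓ := UniversalFactor.norm_Gamma_thetaArg_le ht₀ ht
  have hζ : ‖riemannZeta (1 / 2 + t * I)‖ ≤ 5 * (t + 1 / 2) := by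
    have h := LFDSingle.norm_riemannZeta_le_five_mul (s := 1 / 2 + t * I) (by simp; norm_num)
      (by simp; rw [abs_of_nonneg (by linarith)]; linarith)
    have hn : ‖(1 : ℂ) / 2 + t * I‖ ≤ t + 1 / 2 := by
      refine (Complex.norm_le_abs_re_add_abs_im _).trans ?_
      simp; rw [abs_of_nonneg (by linarith : (0:ℝ) ≤ t)]; norm_num; linarith
    linarith
  have hK := UniversalFactor.lehmerK0_pos t₀
  have hexp : Real.exp (Real.log (t₀ / 2) / 4 + 3 / 64 + π / 4 + 1 + π / 4 * (t₀ - t)) =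
      Real.exp (Real.log (t₀ / 2) / 4 + 3 / 64 + π / 4 + 1) * Real.exp (π / 4 * (t₀ - t)) :=
    Real.exp_add _ _
  have hpoly : (t ^ 2 + 1 / 4) * (5 * (t + 1 / 2)) ≤ 5 * (t + 1) ^ 3 := by nlinarith
  calc (t ^ 2 + 1 / 4) * (Real.exp (-Real.log π / 4) * ‖Complex.Gamma (thetaArg t)‖) *
        ‖riemannZeta (1 / 2 + t * I)‖ / 16
      ≤ (t ^ 2 + 1 / 4) * (Real.exp (-Real.log π / 4) * (‖Complex.Gamma (thetaArg t₀)‖ *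
          Real.exp (Real.log (t₀ / 2) / 4 + 3 / 64 + π / 4 + 1 + π / 4 * (t₀ - t)))) *
        (5 * (t + 1 / 2)) / 16 := by gcongr
    _ = UniversalFactor.lehmerK0 t₀ * Real.exp (Real.log (t₀ / 2) / 4 + 3 / 64 + π / 4 + 1) *
        ((t ^ 2 + 1 / 4) * (5 * (t + 1 / 2))) * Real.exp (π / 4 * (t₀ - t)) := by
        rw [hexp, UniversalFactor.lehmerK0]; ring
    _ ≤ UniversalFactor.lehmerK0 t₀ * Real.exp (Real.log (t₀ / 2) / 4 + 3 / 64 + π / 4 + 1) *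
        (5 * (t + 1) ^ 3) * Real.exp (π / 4 * (t₀ - t)) := by gcongr
    _ = _ := by rw [UniversalFactor.lehmerTailConst]; ring

/-! ## The global bound `‖H_0(x)‖ ≤ ¼` and a lower bound for `K₀` -/

/-- `Γ(¼) ≤ 4` (`Γ(¼) = 4Γ(5/4)`, `Γ ≤ 1` on `[1, 2]` by convexity). [folklore] -/
theorem UniversalFactor.Gamma_quarter_le_four : Real.Gamma (1 / 4) ≤ 4 := by
  have h54 : Real.Gamma (5 / 4) ≤ 1 := by
    have hc := Real.convexOn_Gamma.le_on_segment (x := 1) (y := 2) (z := 5 / 4) (by simp) (by simp)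
      (by rw [segment_eq_Icc (by norm_num)]; norm_num)
    simpa using hc
  have h := Real.Gamma_add_one (s := 1 / 4) (by norm_num)
  rw [show (1 : ℝ) / 4 + 1 = 5 / 4 by norm_num] at h
  linarith

/-- `‖H_0(x)‖ ≤ ¼` for every real `x` (`|H_0(x)| ≤ H_0(0) = |Λ(½)|/64 ≤ Γ(¼)|ζ(½)|/64`). [folklore] -/
theorem UniversalFactor.norm_deBruijnH_zero_le_quarter (x : ℝ) : ‖deBruijnH 0 x‖ ≤ 1 / 4 := by
  refine (UniversalFactor.norm_deBruijnH_zero_ofReal_le x).trans ((Complex.re_le_norm _).trans ?_)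
  have h0 := UniversalFactor.norm_deBruijnH_zero_two_mul_eq 0
  simp only [mul_zero, Complex.ofReal_zero, zero_mul, add_zero] at h0
  rw [h0]
  have hΓ : ‖Complex.Gamma (thetaArg 0)‖ ≤ 4 := by
    rw [thetaArg_zero, Complex.Gamma_ofReal, Complex.norm_real, Real.norm_of_nonneg
      (Real.Gamma_pos_of_pos (by norm_num)).le]
    exact UniversalFactor.Gamma_quarter_le_four
  have hζ : ‖riemannZeta (1 / 2)‖ ≤ 4 := by
    have h := LFDSingle.norm_riemannZeta_le_eight_mul (s := 1 / 2) (by simp; norm_num) (by simp; norm_num)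
    have : ‖((1 : ℂ) / 2)‖ = 1 / 2 := by simp
    linarith
  have hπ : Real.exp (-Real.log π / 4) ≤ 1 := by
    rw [Real.exp_le_one_iff]
    have := Real.log_nonneg (by linarith [Real.pi_gt_three] : (1:ℝ) ≤ π)
    linarith
  have h4 : (0:ℝ) ≤ 4 := by norm_num
  calc ((0:ℝ) ^ 2 + 1 / 4) * (Real.exp (-Real.log π / 4) * ‖Complex.Gamma (thetaArg 0)‖) *
        ‖riemannZeta (1 / 2)‖ / 16
      ≤ (0 ^ 2 + 1 / 4) * (1 * 4) * 4 / 16 := by gcongr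
    _ = 1 / 4 := by norm_num

/-- **Lower bound for `K₀`**: for `t₀ ≥ 2`,
`K₀(t₀) ≥ exp(−log π/4 − log(t₀/2)/4 − π t₀/4 + log(2π)/2 − (3/128 + π/8 + ½))/16`. [folklore] -/
theorem UniversalFactor.lehmerK0_ge {t₀ : ℝ} (ht₀ : 2 ≤ t₀) :
    Real.exp (-Real.log π / 4 + (-Real.log (t₀ / 2) / 4 - π * t₀ / 4 + Real.log (2 * π) / 2 -
      (3 / 128 + π / 8 + 1 / 2))) / 16 ≤ UniversalFactor.lehmerK0 t₀ := by
  have h := GammaStirling.abs_log_norm_Gamma_vertical_sub_le_of_pos (x := 1 / 4) (u := t₀ / 2)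
      (by norm_num) (by rw [abs_of_nonneg (by linarith)]; linarith)
  have e : (((1 / 4 : ℝ) : ℂ) + ((t₀ / 2 : ℝ) : ℂ) * I) = thetaArg t₀ := by
    simp only [thetaArg]; push_cast; ring
  rw [e, abs_of_nonneg (by linarith : 0 ≤ t₀ / 2)] at h
  have hΓ0 : 0 < ‖Complex.Gamma (thetaArg t₀)‖ :=
    norm_pos_iff.2 (Complex.Gamma_ne_zero_of_re_pos (thetaArg_re_pos t₀))
  rw [UniversalFactor.lehmerK0, Real.exp_add]
  have hlow : Real.exp (-Real.log (t₀ / 2) / 4 - π * t₀ / 4 + Real.log (2 * π) / 2 -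
      (3 / 128 + π / 8 + 1 / 2)) ≤ ‖Complex.Gamma (thetaArg t₀)‖ := by
    rw [← Real.exp_log hΓ0, Real.exp_le_exp]
    have := (abs_le.1 h).1
    nlinarith
  have := Real.exp_pos (-Real.log π / 4)
  nlinarith

/-! ## The tail integrals -/

/-- Polynomial growth is absorbed by `e^{−(π/8)y}`: for `t₀ ≥ 4`, `y ≥ 0`,
`(t₀ + y/2 + 1)³ e^{−(π/8) y} ≤ (t₀ + 1)³`. [folklore] -/
theorem UniversalFactor.cube_mul_exp_le {t₀ y : ℝ} (ht₀ : 4 ≤ t₀) (hy : 0 ≤ y) :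
    (t₀ + y / 2 + 1) ^ 3 * Real.exp (-(π / 8 * y)) ≤ (t₀ + 1) ^ 3 := by
  have h1 : 0 < t₀ + 1 := by linarith
  set u : ℝ := y / (2 * (t₀ + 1)) with hu
  have hu0 : 0 ≤ u := by positivity
  have hfac : t₀ + y / 2 + 1 = (t₀ + 1) * (1 + u) := by rw [hu]; field_simp; ring
  have hexp : (1 + u) ^ 3 ≤ Real.exp (π / 8 * y) := by
    have h2 : 1 + u ≤ Real.exp u := by linarith [Real.add_one_le_exp u]
    have h3 : (1 + u) ^ 3 ≤ Real.exp u ^ 3 := pow_le_pow_left₀ (by linarith) h2 3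
    have h4 : Real.exp u ^ 3 = Real.exp (3 * u) := by rw [← Real.exp_nat_mul]; norm_num
    have h5 : 3 * u ≤ π / 8 * y := by
      rw [hu]
      have : 3 * (y / (2 * (t₀ + 1))) = (3 / (2 * (t₀ + 1))) * y := by ring
      rw [this]
      refine mul_le_mul_of_nonneg_right ?_ hy
      rw [div_le_iff₀ (by positivity)]
      nlinarith [Real.pi_gt_three]
    calc (1 + u) ^ 3 ≤ Real.exp u ^ 3 := h3
      _ = Real.exp (3 * u) := h4
      _ ≤ Real.exp (π / 8 * y) := Real.exp_le_exp.2 h5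
  rw [hfac, mul_pow, mul_assoc]
  have : (1 + u) ^ 3 * Real.exp (-(π / 8 * y)) ≤ 1 := by
    rw [Real.exp_neg, ← div_eq_mul_inv, div_le_one (Real.exp_pos _)]
    exact hexp
  calc (t₀ + 1) ^ 3 * ((1 + u) ^ 3 * Real.exp (-(π / 8 * y))) ≤ (t₀ + 1) ^ 3 * 1 :=
        mul_le_mul_of_nonneg_left this (by positivity)
    _ = (t₀ + 1) ^ 3 := mul_one _

/-- **Tail of the forward average.** For `t₀ ≥ 4` and `Y ≥ 0`:
`∫_{y>Y} ‖H_0(2t₀ + y) e^{−16y}‖ dy ≤ K₀ · C(t₀) (t₀+1)³ e^{−16Y}/16`. [folklore] -/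
theorem UniversalFactor.lehmer_tail_Q {t₀ Y : ℝ} (ht₀ : 4 ≤ t₀) (hY : 0 ≤ Y) :
    ∫ y in Ioi Y, ‖deBruijnH 0 (((2 * t₀ : ℝ) : ℂ) + (y : ℂ)) * (Real.exp (-(16 * y)) : ℂ)‖ ≤
      UniversalFactor.lehmerK0 t₀ *
        (UniversalFactor.lehmerTailConst t₀ * (t₀ + 1) ^ 3 * Real.exp (-(16 * Y)) / 16) := by
  set A : ℝ := UniversalFactor.lehmerK0 t₀ * UniversalFactor.lehmerTailConst t₀ * (t₀ + 1) ^ 3 with hA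
  have hK := UniversalFactor.lehmerK0_pos t₀
  have hC : 0 < UniversalFactor.lehmerTailConst t₀ := by unfold UniversalFactor.lehmerTailConst; positivity
  have hA0 : 0 ≤ A := by positivity
  -- pointwise bound
  have hpt : ∀ y ∈ Ioi Y, ‖deBruijnH 0 (((2 * t₀ : ℝ) : ℂ) + (y : ℂ)) * (Real.exp (-(16 * y)) : ℂ)‖ ≤
      A * Real.exp (-16 * y) := by
    intro y hy
    have hy0 : 0 ≤ y := hY.trans (le_of_lt hy)
    rw [norm_mul, Complex.norm_real, Real.norm_of_nonneg (Real.exp_pos _).le,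
      show (((2 * t₀ : ℝ) : ℂ) + (y : ℂ)) = ((2 * (t₀ + y / 2) : ℝ) : ℂ) by push_cast; ring]
    have h := UniversalFactor.norm_deBruijnH_zero_two_mul_le (t₀ := t₀) (t := t₀ + y / 2)
      (by linarith) (by linarith)
    have hcube := UniversalFactor.cube_mul_exp_le ht₀ hy0
    have e1 : Real.exp (π / 4 * (t₀ - (t₀ + y / 2))) = Real.exp (-(π / 8 * y)) := by
      congr 1; ring
    rw [e1] at h
    have e2 : Real.exp (-(16 * y)) = Real.exp (-16 * y) := by congr 1; ring
    rw [e2]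
    calc ‖deBruijnH 0 ((2 * (t₀ + y / 2) : ℝ) : ℂ)‖ * Real.exp (-16 * y)
        ≤ UniversalFactor.lehmerK0 t₀ * UniversalFactor.lehmerTailConst t₀ * (t₀ + y / 2 + 1) ^ 3 *
            Real.exp (-(π / 8 * y)) * Real.exp (-16 * y) :=
          mul_le_mul_of_nonneg_right h (Real.exp_pos _).le
      _ = UniversalFactor.lehmerK0 t₀ * UniversalFactor.lehmerTailConst t₀ *
            ((t₀ + y / 2 + 1) ^ 3 * Real.exp (-(π / 8 * y))) * Real.exp (-16 * y) := by ring
      _ ≤ UniversalFactor.lehmerK0 t₀ * UniversalFactor.lehmerTailConst t₀ * (t₀ + 1) ^ 3 *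
            Real.exp (-16 * y) := by gcongr
  -- integrate the majorant
  have hg : IntegrableOn (fun y : ℝ => A * Real.exp (-16 * y)) (Ioi Y) :=
    (integrableOn_exp_mul_Ioi (by norm_num) Y).const_mul A
  have hmono := integral_mono_of_nonneg (μ := volume.restrict (Ioi Y))
    (Filter.Eventually.of_forall fun y => norm_nonneg
      (deBruijnH 0 (((2 * t₀ : ℝ) : ℂ) + (y : ℂ)) * (Real.exp (-(16 * y)) : ℂ)))
    hg ((ae_restrict_iff' measurableSet_Ioi).2 (Filter.Eventually.of_forall hpt))
  refine hmono.trans (le_of_eq ?_)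
  rw [integral_const_mul, integral_exp_mul_Ioi (by norm_num) Y, hA]
  ring

/-- `e^{−16(2t₀−4)}/64 ≤ K₀(t₀)` for `t₀ ≥ 4` (the far tail, where only `|H_0| ≤ ¼` is used, is
negligible even against the astronomically small `K₀`). [folklore] -/
theorem UniversalFactor.exp_far_le_lehmerK0 {t₀ : ℝ} (ht₀ : 4 ≤ t₀) :
    Real.exp (-16 * (2 * t₀ - 4)) / 64 ≤ UniversalFactor.lehmerK0 t₀ := by
  refine le_trans ?_ (UniversalFactor.lehmerK0_ge (by linarith))
  have hlogπ : Real.log π ≤ 2 := by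
    rw [Real.log_le_iff_le_exp Real.pi_pos]
    have h1 : (2.7 : ℝ) < Real.exp 1 := lt_trans (by norm_num) Real.exp_one_gt_d9
    have h2 : Real.exp 2 = Real.exp 1 * Real.exp 1 := by rw [← Real.exp_add]; norm_num
    nlinarith [Real.pi_lt_four, Real.exp_pos 1]
  have hlogt : Real.log (t₀ / 2) ≤ t₀ / 2 := (Real.log_le_sub_one_of_pos (by linarith)).trans (by linarith)
  have hlog2π : 0 ≤ Real.log (2 * π) := Real.log_nonneg (by linarith [Real.pi_gt_three])
  have hπ4 := Real.pi_lt_four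
  have key : -16 * (2 * t₀ - 4) ≤ -Real.log π / 4 + (-Real.log (t₀ / 2) / 4 - π * t₀ / 4 +
      Real.log (2 * π) / 2 - (3 / 128 + π / 8 + 1 / 2)) := by nlinarith
  have h := Real.exp_le_exp.2 key
  have := Real.exp_pos (-Real.log π / 4 + (-Real.log (t₀ / 2) / 4 - π * t₀ / 4 +
      Real.log (2 * π) / 2 - (3 / 128 + π / 8 + 1 / 2)))
  linarith

/-- **Tail of the backward average.** For `4 ≤ t₀` and `0 ≤ Y ≤ 2t₀ − 4`:
`∫_{y>Y} ‖H_0(2t₀ − y) e^{−16y}‖ dy ≤ K₀ · (C(t₀)(t₀+1)³ e^{−(16−π/8)Y}/(16−π/8) + 1)`. [folklore] -/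
theorem UniversalFactor.lehmer_tail_P {t₀ Y : ℝ} (ht₀ : 4 ≤ t₀) (hY : 0 ≤ Y) (hY' : Y ≤ 2 * t₀ - 4) :
    ∫ y in Ioi Y, ‖deBruijnH 0 (((2 * t₀ : ℝ) : ℂ) - (y : ℂ)) * (Real.exp (-(16 * y)) : ℂ)‖ ≤
      UniversalFactor.lehmerK0 t₀ *
        (UniversalFactor.lehmerTailConst t₀ * (t₀ + 1) ^ 3 * Real.exp (-((16 - π / 8) * Y)) / (16 - π / 8) + 1) := by
  set A : ℝ := UniversalFactor.lehmerK0 t₀ * UniversalFactor.lehmerTailConst t₀ * (t₀ + 1) ^ 3 with hA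
  set y₁ : ℝ := 2 * t₀ - 4 with hy₁
  have hK := UniversalFactor.lehmerK0_pos t₀
  have hC : 0 < UniversalFactor.lehmerTailConst t₀ := by unfold UniversalFactor.lehmerTailConst; positivity
  have hA0 : 0 ≤ A := by positivity
  have hrate : (0:ℝ) < 16 - π / 8 := by nlinarith [Real.pi_lt_four]
  -- the majorant
  set g : ℝ → ℝ := fun y => A * Real.exp (-(16 - π / 8) * y) +
    (Ioi y₁).indicator (fun y => (1 / 4 : ℝ) * Real.exp (-16 * y)) y with hg_def
  have hpt : ∀ y ∈ Ioi Y, ‖deBruijnH 0 (((2 * t₀ : ℝ) : ℂ) - (y : ℂ)) * (Real.exp (-(16 * y)) : ℂ)‖ ≤ g y := by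
    intro y hy
    have hy0 : 0 ≤ y := hY.trans (le_of_lt hy)
    rw [norm_mul, Complex.norm_real, Real.norm_of_nonneg (Real.exp_pos _).le,
      show (((2 * t₀ : ℝ) : ℂ) - (y : ℂ)) = ((2 * (t₀ - y / 2) : ℝ) : ℂ) by push_cast; ring]
    have hfirst0 : 0 ≤ A * Real.exp (-(16 - π / 8) * y) := by positivity
    have hind0 : 0 ≤ (Ioi y₁).indicator (fun y => (1 / 4 : ℝ) * Real.exp (-16 * y)) y :=
      Set.indicator_nonneg (fun _ _ => by positivity) _
    rcases le_or_gt y y₁ with hle | hgt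
    · -- `t = t₀ − y/2 ≥ 2`
      have h := UniversalFactor.norm_deBruijnH_zero_two_mul_le (t₀ := t₀) (t := t₀ - y / 2)
        (by linarith) (by rw [hy₁] at hle; linarith)
      have e1 : Real.exp (π / 4 * (t₀ - (t₀ - y / 2))) = Real.exp (π / 8 * y) := by congr 1; ring
      rw [e1] at h
      have hcube : (t₀ - y / 2 + 1) ^ 3 ≤ (t₀ + 1) ^ 3 :=
        pow_le_pow_left₀ (by linarith) (by linarith) 3
      calc ‖deBruijnH 0 ((2 * (t₀ - y / 2) : ℝ) : ℂ)‖ * Real.exp (-(16 * y))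
          ≤ UniversalFactor.lehmerK0 t₀ * UniversalFactor.lehmerTailConst t₀ * (t₀ - y / 2 + 1) ^ 3 *
              Real.exp (π / 8 * y) * Real.exp (-(16 * y)) :=
            mul_le_mul_of_nonneg_right h (Real.exp_pos _).le
        _ ≤ UniversalFactor.lehmerK0 t₀ * UniversalFactor.lehmerTailConst t₀ * (t₀ + 1) ^ 3 *
              Real.exp (π / 8 * y) * Real.exp (-(16 * y)) := by gcongr
        _ = A * Real.exp (-(16 - π / 8) * y) := by
            rw [hA, mul_assoc, ← Real.exp_add]; congr 1; congr 1; ring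
        _ ≤ g y := by simp only [hg_def]; linarith
    · -- `y > y₁`: the crude bound `‖H_0‖ ≤ 1/4`
      have h := UniversalFactor.norm_deBruijnH_zero_le_quarter (2 * (t₀ - y / 2))
      have hind : (Ioi y₁).indicator (fun y => (1 / 4 : ℝ) * Real.exp (-16 * y)) y =
          1 / 4 * Real.exp (-16 * y) := Set.indicator_of_mem hgt _
      calc ‖deBruijnH 0 ((2 * (t₀ - y / 2) : ℝ) : ℂ)‖ * Real.exp (-(16 * y))
          ≤ 1 / 4 * Real.exp (-(16 * y)) := mul_le_mul_of_nonneg_right h (Real.exp_pos _).le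
        _ = 1 / 4 * Real.exp (-16 * y) := by congr 1; congr 1; ring
        _ ≤ g y := by simp only [hg_def]; rw [hind]; linarith
  -- integrability and integral of the majorant
  have hg1 : IntegrableOn (fun y : ℝ => A * Real.exp (-(16 - π / 8) * y)) (Ioi Y) :=
    (integrableOn_exp_mul_Ioi (by linarith) Y).const_mul A
  have hg2 : IntegrableOn (fun y : ℝ => (Ioi y₁).indicator (fun y => (1 / 4 : ℝ) * Real.exp (-16 * y)) y)
      (Ioi Y) :=
    (((integrableOn_exp_mul_Ioi (by norm_num) Y).const_mul (1 / 4 : ℝ)).indicator measurableSet_Ioi)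
  have hgi : IntegrableOn g (Ioi Y) := hg1.add hg2
  have hmono := integral_mono_of_nonneg (μ := volume.restrict (Ioi Y))
    (Filter.Eventually.of_forall fun y => norm_nonneg
      (deBruijnH 0 (((2 * t₀ : ℝ) : ℂ) - (y : ℂ)) * (Real.exp (-(16 * y)) : ℂ)))
    hgi ((ae_restrict_iff' measurableSet_Ioi).2 (Filter.Eventually.of_forall hpt))
  refine hmono.trans ?_
  have hI1 : ∫ y in Ioi Y, A * Real.exp (-(16 - π / 8) * y) =
      A * Real.exp (-((16 - π / 8) * Y)) / (16 - π / 8) := by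
    rw [integral_const_mul, integral_exp_mul_Ioi (by linarith) Y]
    have : -(16 - π / 8) * Y = -((16 - π / 8) * Y) := by ring
    rw [this]; field_simp
  have hI2 : ∫ y in Ioi Y, (Ioi y₁).indicator (fun y => (1 / 4 : ℝ) * Real.exp (-16 * y)) y =
      1 / 4 * (Real.exp (-16 * y₁) / 16) := by
    rw [integral_indicator measurableSet_Ioi, Measure.restrict_restrict measurableSet_Ioi,
      Ioi_inter_Ioi, sup_eq_left.2 hY', integral_const_mul, integral_exp_mul_Ioi (by norm_num) y₁]
    ring
  rw [hg_def, integral_add hg1 hg2, hI1, hI2]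
  have hfar := UniversalFactor.exp_far_le_lehmerK0 ht₀
  rw [hy₁]
  have : 1 / 4 * (Real.exp (-16 * (2 * t₀ - 4)) / 16) = Real.exp (-16 * (2 * t₀ - 4)) / 64 := by ring
  rw [this, hA]
  have e : UniversalFactor.lehmerK0 t₀ * (UniversalFactor.lehmerTailConst t₀ * (t₀ + 1) ^ 3 *
      Real.exp (-((16 - π / 8) * Y)) / (16 - π / 8) + 1) =
      UniversalFactor.lehmerK0 t₀ * UniversalFactor.lehmerTailConst t₀ * (t₀ + 1) ^ 3 *
        Real.exp (-((16 - π / 8) * Y)) / (16 - π / 8) + UniversalFactor.lehmerK0 t₀ := by ring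
  rw [e]
  linarith

end Summit.RiemannHypothesis.RiemannHypothesis.Theorems
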